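import Mathlib
import Literature.Computability.AlgebraicComplexity.EquivariantDC
import Summits.ValiantsHypothesis.ValiantsHypothesis.Theorems.FreeSubtorusOrbitDimensionBoundStubSignDiagonalise

/-!
# `OrbitDimensionBound` (stmt-ValiantsHypothesis-16133), rung line `affine_gauge` — stub `stub_nilpotentGauge`

The line `Cruxes/OrbitDimensionBound/Lines/affine_gauge.lean` (route `FreeSubtorus`, rung `Gauge.AffineGaugeShadow`:
symmetry modulo AFFINE UNIMODULAR GAUGE) registers three stubs; this file proves the first, the STRUCTURE of affine
unimodular gauge:

  `stub_nilpotentGauge : Stmt.stub_nilpotentGauge` (statement = `GaugeLifts 1 S B → NilLifts S B` with both Cruxes-side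
  predicates of `Lines/GaugeLadder.lean` / `affine_gauge.lean` UNFOLDED; no definitions here).

**The normal form** (`exists_const_mul_unipotent`).  A matrix `g ∈ M_m(ℂ[x])` with entries of total degree `≤ 1` and
`det g ∈ ℂ[x]ˣ` factors as `g = C(g₀) · (1 + N)` with `g₀ = g(0) ∈ GL_m(ℂ)` and `N` a matrix of homogeneous LINEAR forms
with `N^m = 0`.  Proof: units of `ℂ[x]` are constants (`MvPolynomial.isUnit_iff_eq_C_of_isReduced`), so `det g = C c`,
`c ≠ 0`, and `det g₀ = constantCoeff (det g) = c` (`RingHom.map_det`); put `N = C(g₀⁻¹) · g₁` (`g₁` = the linear part, an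
explicit matrix of linear forms).  Then `det (1 + N) = c⁻¹ · c = 1`; the scaling endomorphisms `x ↦ t·x` (`t ∈ ℂ`) of `ℂ[x]`
multiply linear forms by `t`, so `det (1 + t • N) = 1` for every `t ∈ ℂ`, i.e. the reverse characteristic polynomial
`det (1 − T • N) ∈ ℂ[x][T]` takes the value `1` at the infinitely many points `T = −C t`: it IS `1`
(`Polynomial.eq_zero_of_infinite_isRoot` over the domain `ℂ[x]`), hence (`Matrix.reverse_charpoly`, monicity, degree `m`)
`charpoly N = T^m` and `N^m = 0` by Cayley–Hamilton (`Matrix.aeval_self_charpoly`).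

Helper mode (`--supports stmt-ValiantsHypothesis-16133 --as helper`): the item's registered skeleton is `affine_multiple`;
no stub credit moves.  Honest framing: bookkeeping stub of a rung line whose cores `stub_untwist` (L, open) and
`stub_gaugeReduction` remain OPEN; the crux `OrbitDimensionBound`, the route `FreeSubtorus` and VP ≠ VNP are OPEN and NOT
moved by this file.

## References
* [LandsbergRessayre2017] J. M. Landsberg, N. Ressayre, *Permanent v. determinant: an exponential lower bound assuming
  symmetry and a potential path towards Valiant's conjecture*, Differential Geom. Appl. 55 (2017), Def. 1.3, §6.
-/

open Matrix MvPolynomial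
open Literature.Computability.AlgebraicComplexity
open Summit.ValiantsHypothesis.ValiantsHypothesis.Theorems.FreeSubtorusOrbitDimensionBound.SignCovering
  (eq_C_add_sum_smul_X_of_totalDegree_le_one)

-- the mandated summit-side namespace repeats a component by design (single-problem summit)
set_option linter.dupNamespace false

namespace Summit.ValiantsHypothesis.ValiantsHypothesis.Theorems.FreeSubtorusOrbitDimensionBound.AffineGauge

noncomputable section

variable {σ : Type*} [Fintype σ] [DecidableEq σ] {m : ℕ}

/-! ### §1 Polynomials whose reverse is `1` -/

/-- A monic polynomial of degree `m` whose reverse is `1` is `X^m`. [folklore] -/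
theorem eq_X_pow_of_reverse_eq_one {R : Type*} [CommRing R] (p : Polynomial R) (hmonic : p.Monic) {k : ℕ}
    (hdeg : p.natDegree = k) (hrev : p.reverse = 1) : p = Polynomial.X ^ k := by
  ext j
  rw [Polynomial.coeff_X_pow]
  by_cases hj : j = k
  · subst hj
    rw [if_pos rfl, ← hdeg]
    exact hmonic.coeff_natDegree
  · rw [if_neg hj]
    rcases lt_or_gt_of_ne hj with hlt | hgt
    · -- `coeff p j = coeff (reverse p) (k - j) = coeff 1 (k - j) = 0`
      have h := Polynomial.coeff_reverse p (k - j)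
      rw [hrev, hdeg, Polynomial.revAt_le (Nat.sub_le k j), Nat.sub_sub_self hlt.le, Polynomial.coeff_one] at h
      rw [← h, if_neg (by omega)]
    · exact Polynomial.coeff_eq_zero_of_natDegree_lt (by omega)

/-! ### §2 Nilpotency from `det (1 + t • N) = 1` for all scalars `t` -/

omit [Fintype σ] [DecidableEq σ] in
/-- Over the domain `ℂ[x]`: if `det (1 + C t • N) = 1` for every `t ∈ ℂ` then `N^m = 0` (the reverse characteristic
polynomial has infinitely many roots of `· − 1`, so `charpoly N = T^m`; Cayley–Hamilton). [folklore] -/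
theorem pow_eq_zero_of_det_one_add_smul (N : Matrix (Fin m) (Fin m) (MvPolynomial σ ℂ))
    (h : ∀ t : ℂ, (1 + (C t : MvPolynomial σ ℂ) • N).det = 1) : N ^ m = 0 := by
  classical
  -- the reverse characteristic polynomial is `1`
  have hrev : N.charpolyRev = 1 := by
    have hroot : ∀ t : ℂ, Polynomial.IsRoot (N.charpolyRev - 1) (C (-t)) := by
      intro t
      rw [Polynomial.IsRoot, Polynomial.eval_sub, Polynomial.eval_one, sub_eq_zero, Matrix.charpolyRev,
        ← Polynomial.coe_evalRingHom, RingHom.map_det]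
      have hM : (Polynomial.evalRingHom (C (-t) : MvPolynomial σ ℂ)).mapMatrix
          (1 - (Polynomial.X : Polynomial (MvPolynomial σ ℂ)) • N.map Polynomial.C) =
          1 + (C t : MvPolynomial σ ℂ) • N := by
        ext i j
        simp only [RingHom.mapMatrix_apply, Matrix.map_apply, Matrix.sub_apply, Matrix.add_apply, Matrix.smul_apply,
          Matrix.map_apply, smul_eq_mul, Polynomial.coe_evalRingHom, Polynomial.eval_sub, Polynomial.eval_mul,
          Polynomial.eval_X, Polynomial.eval_C, map_neg]
        rw [Matrix.one_apply, Matrix.one_apply]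
        split_ifs <;> simp
      rw [hM]
      exact h t
    have hinf : Set.Infinite {x : MvPolynomial σ ℂ | Polynomial.IsRoot (N.charpolyRev - 1) x} := by
      have hsub : Set.range (fun t : ℂ => (C (-t) : MvPolynomial σ ℂ)) ⊆
          {x : MvPolynomial σ ℂ | Polynomial.IsRoot (N.charpolyRev - 1) x} := by
        rintro x ⟨t, rfl⟩
        exact hroot t
      refine Set.Infinite.mono hsub (Set.infinite_range_of_injective ?_)
      intro t t' htt'
      have := (C_injective σ ℂ) htt'
      exact neg_injective this
    have := Polynomial.eq_zero_of_infinite_isRoot _ hinf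
    exact (sub_eq_zero.mp this)
  -- hence `charpoly N = X^m`
  have hchar : N.charpoly = Polynomial.X ^ m := by
    refine eq_X_pow_of_reverse_eq_one N.charpoly (Matrix.charpoly_monic N) ?_ ?_
    · rw [Matrix.charpoly_natDegree_eq_dim, Fintype.card_fin]
    · rw [Matrix.reverse_charpoly, hrev]
  -- Cayley–Hamilton
  have hCH := Matrix.aeval_self_charpoly N
  rwa [hchar, map_pow, Polynomial.aeval_X] at hCH

/-! ### §3 The normal form of an affine unimodular matrix -/

/-- **Affine unimodular gauge is constant × unipotent.**  A matrix of affine forms with unit determinant is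
`C(g₀) · (1 + N)`, `g₀ ∈ GL_m(ℂ)`, `N` homogeneous linear with `N^m = 0`. [folklore] -/
theorem exists_const_mul_unipotent (g : Matrix (Fin m) (Fin m) (MvPolynomial σ ℂ))
    (hdeg : ∀ i j, (g i j).totalDegree ≤ 1) (hunit : IsUnit g.det) :
    ∃ (g₀ : GL (Fin m) ℂ) (N : Matrix (Fin m) (Fin m) (MvPolynomial σ ℂ)),
      (∀ i j, (N i j).IsHomogeneous 1) ∧ N ^ m = 0 ∧
      g = (g₀ : Matrix (Fin m) (Fin m) ℂ).map C * (1 + N) := by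
  classical
  -- the determinant is a non-zero constant
  obtain ⟨c, hc, hdet⟩ := MvPolynomial.isUnit_iff_eq_C_of_isReduced.mp hunit
  have hc0 : c ≠ 0 := hc.ne_zero
  -- the constant part `g₀` and its determinant
  set g₀m : Matrix (Fin m) (Fin m) ℂ := g.map constantCoeff with hg₀m
  have hdet₀ : g₀m.det = c := by
    have := RingHom.map_det (constantCoeff : MvPolynomial σ ℂ →+* ℂ) g
    rw [hdet, constantCoeff_C] at this
    rw [hg₀m, this]
    rfl
  have hU : IsUnit g₀m := (Matrix.isUnit_iff_isUnit_det g₀m).mpr (hdet₀ ▸ isUnit_iff_ne_zero.mpr hc0)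
  obtain ⟨g₀, hg₀⟩ := hU
  -- the linear part, as explicit linear forms
  set a : Fin m → Fin m → σ → ℂ := fun i j v => coeff (Finsupp.single v 1) (g i j) with ha
  have hsplit : ∀ i j, g i j = C (g₀m i j) + ∑ v, a i j v • X v := by
    intro i j
    rw [hg₀m, Matrix.map_apply, constantCoeff_eq, ha]
    exact eq_C_add_sum_smul_X_of_totalDegree_le_one (hdeg i j)
  set g₁ : Matrix (Fin m) (Fin m) (MvPolynomial σ ℂ) := Matrix.of fun i j => ∑ v, a i j v • X v with hg₁
  have hg : g = g₀m.map C + g₁ := by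
    refine Matrix.ext fun i j => ?_
    rw [Matrix.add_apply, Matrix.map_apply, hg₁, Matrix.of_apply]
    exact hsplit i j
  -- `N = C(g₀⁻¹) · g₁`, with explicit linear-form entries
  set ginv : Matrix (Fin m) (Fin m) ℂ := ((g₀⁻¹ : (Matrix (Fin m) (Fin m) ℂ)ˣ) : Matrix (Fin m) (Fin m) ℂ) with hginv
  have hginv_mul : ginv * g₀m = 1 := by rw [hginv, ← hg₀, Units.inv_mul]
  have hmul_ginv : g₀m * ginv = 1 := by rw [hginv, ← hg₀, Units.mul_inv]
  set N : Matrix (Fin m) (Fin m) (MvPolynomial σ ℂ) := ginv.map C * g₁ with hN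
  set b : Fin m → Fin m → σ → ℂ := fun i j v => ∑ k, ginv i k * a k j v with hb
  have hNentry : ∀ i j, N i j = ∑ v, b i j v • X v := by
    intro i j
    rw [hN, Matrix.mul_apply]
    simp only [Matrix.map_apply, hg₁, Matrix.of_apply, Finset.mul_sum, hb, Finset.sum_smul]
    rw [Finset.sum_comm]
    refine Finset.sum_congr rfl fun v _ => Finset.sum_congr rfl fun k _ => ?_
    rw [smul_eq_C_mul, smul_eq_C_mul, map_mul, mul_assoc]
  refine ⟨g₀, N, fun i j => ?_, ?_, ?_⟩
  · -- homogeneous of degree one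
    rw [hNentry]
    refine IsHomogeneous.sum _ _ _ fun v _ => ?_
    rw [smul_eq_C_mul, ← zero_add 1]
    exact (isHomogeneous_C _ _).mul (isHomogeneous_X _ _)
  · -- nilpotent
    apply pow_eq_zero_of_det_one_add_smul
    intro t
    -- `det (1 + N) = 1`
    have h1N : 1 + N = ginv.map C * g := by
      rw [hg, Matrix.mul_add, ← Matrix.map_mul, hginv_mul, Matrix.map_one C (map_zero C) (map_one C), hN]
    have hdet1 : (1 + N).det = 1 := by
      rw [h1N, Matrix.det_mul, hdet]
      have : (ginv.map (C : ℂ →+* MvPolynomial σ ℂ)).det = C ginv.det := by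
        rw [← RingHom.mapMatrix_apply, ← RingHom.map_det]
      rw [this, ← map_mul, ← map_one C]
      congr 1
      have h2 : ginv.det * g₀m.det = 1 := by rw [← Matrix.det_mul, hginv_mul, Matrix.det_one]
      rw [hdet₀] at h2
      exact h2
    -- scaling endomorphism `x ↦ t • x`
    let φ : MvPolynomial σ ℂ →ₐ[ℂ] MvPolynomial σ ℂ := aeval fun v => t • X v
    have hφN : ∀ i j, φ (N i j) = (C t : MvPolynomial σ ℂ) * N i j := by
      intro i j
      rw [hNentry, map_sum, Finset.mul_sum]
      refine Finset.sum_congr rfl fun v _ => ?_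
      rw [map_smul, aeval_X, smul_eq_C_mul, smul_eq_C_mul, smul_eq_C_mul]
      ring
    have hφM : φ.mapMatrix (1 + N) = 1 + (C t : MvPolynomial σ ℂ) • N := by
      refine Matrix.ext fun i j => ?_
      simp only [AlgHom.mapMatrix_apply, Matrix.map_apply, Matrix.add_apply, Matrix.smul_apply, smul_eq_mul,
        map_add, hφN, Matrix.one_apply]
      split_ifs <;> simp
    have := congrArg φ hdet1
    rw [map_one, AlgHom.map_det, hφM] at this
    exact this
  · -- the factorisation
    rw [hg, Matrix.mul_add, Matrix.mul_one, hN, ← Matrix.mul_assoc, ← Matrix.map_mul, ← hg₀]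
    congr 1
    rw [hg₀, hmul_ginv, Matrix.map_one C (map_zero C) (map_one C), Matrix.one_mul]

/-! ### §4 The stub -/

/-- **Stub `stub_nilpotentGauge` of the line `affine_gauge`** (statement = `GaugeLifts 1 S B → NilLifts S B` with both
predicates unfolded): degree-`1` unimodular lifts `B(γ·x) · h = g · B` are, after the normal form `exists_const_mul_unipotent`
applied to `g` and `h`, of the shape «constant × unipotent Koszul twist». [folklore] -/
theorem stub_nilpotentGauge :
    ∀ (n m : ℕ) (S : Set (GL (Fin n × Fin n) ℂ)) (B : Matrix (Fin m) (Fin m) (MvPolynomial (Fin n × Fin n) ℂ)),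
    (∀ γ ∈ S, ∃ g h : Matrix (Fin m) (Fin m) (MvPolynomial (Fin n × Fin n) ℂ),
      (∀ i j, (g i j).totalDegree ≤ 1) ∧ (∀ i j, (h i j).totalDegree ≤ 1) ∧
      IsUnit g.det ∧ IsUnit h.det ∧
      Matrix.linSubstEntries γ B * h = g * B) →
    ∀ γ ∈ S, ∃ (g₀ h₀ : GL (Fin m) ℂ) (Ng Nh : Matrix (Fin m) (Fin m) (MvPolynomial (Fin n × Fin n) ℂ)),
      (∀ i j, (Ng i j).IsHomogeneous 1) ∧ (∀ i j, (Nh i j).IsHomogeneous 1) ∧ Ng ^ m = 0 ∧ Nh ^ m = 0 ∧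
      Matrix.linSubstEntries γ B * ((h₀ : Matrix (Fin m) (Fin m) ℂ).map C * (1 + Nh)) =
        ((g₀ : Matrix (Fin m) (Fin m) ℂ).map C * (1 + Ng)) * B := by
  intro n m S B hlifts γ hγ
  obtain ⟨g, h, hgdeg, hhdeg, hgunit, hhunit, heq⟩ := hlifts γ hγ
  obtain ⟨g₀, Ng, hNg, hNgm, hgfac⟩ := exists_const_mul_unipotent g hgdeg hgunit
  obtain ⟨h₀, Nh, hNh, hNhm, hhfac⟩ := exists_const_mul_unipotent h hhdeg hhunit
  refine ⟨g₀, h₀, Ng, Nh, hNg, hNh, hNgm, hNhm, ?_⟩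
  rw [← hgfac, ← hhfac]
  exact heq

end

end Summit.ValiantsHypothesis.ValiantsHypothesis.Theorems.FreeSubtorusOrbitDimensionBound.AffineGauge
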